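import Mathlib

/-!
# T5UnitaryCoframe — the real orthonormal frame `e₁, Ie₁, e₂, Ie₂` of a unitary frame

Tier-5 support of seat p6 (Hodge-theoretic side of N1, cell pub-hodge-repro2): the first
sentence of the proof of Lemma H2.1 (route/T5-N1-hodge-p6.md): «Take a ℂ-basis `e₁, e₂` of
`T_sS` with `h(e_i, e_j) = δ_{ij}`; then `e₁, Ie₁, e₂, Ie₂` is a `g`-orthonormal real basis»
(`g = Re h`). This is the step that reduces the computation of `α ∧ β̄` for an ARBITRARY
hermitian metric to the six-coefficient model of `T5HodgeStar` in the orthonormal coframe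
`dx₁, dy₁, dx₂, dy₂` dual to that real basis.

Statements, for a complex inner product space `E` (Mathlib's convention: the inner product is
conjugate-linear in the first variable) and a ℂ-orthonormal pair `v : Fin 2 → E`; the real
frame is indexed by `Fin 2 × Bool`, `(k, false) ↦ e_k`, `(k, true) ↦ I e_k`:
* `realFrame v` is orthonormal for `g = re ⟪·,·⟫` (`re_inner_realFrame`);
* it is ℝ-linearly independent (`linearIndependent_realFrame`, proved directly from the
  orthonormality, without invoking a real inner-product-space structure on `E`);
* if `finrank ℂ E = 2` it is an ℝ-basis (`realBasis`), and such a unitary pair exists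
  (`exists_orthonormal_pair`); `exists_realBasis_orthonormal` packages the sentence.
The orientation («positively oriented») is not treated here (p1's `T5Orientation` carries the
determinant computation in coordinates).
-/

namespace Summit.Ventures.HodgeRepro2.T5UnitaryCoframe

open Complex Module

variable {E : Type*} [NormedAddCommGroup E] [InnerProductSpace ℂ E]

/-- The scalar attached to the two members of a real pair: `1` for `e_k`, `I` for `I e_k`. -/
def twist (s : Bool) : ℂ := if s then I else 1

/-- The real frame `e₁, Ie₁, e₂, Ie₂` attached to a complex pair `v`, indexed by
`Fin 2 × Bool`: `(k, false) ↦ v k`, `(k, true) ↦ I • v k`. -/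
def realFrame (v : Fin 2 → E) : Fin 2 × Bool → E := fun p => twist p.2 • v p.1

/-- `realFrame v (k, false) = v k`. -/
theorem realFrame_false (v : Fin 2 → E) (k : Fin 2) : realFrame v (k, false) = v k := by
  simp [realFrame, twist]

/-- `realFrame v (k, true) = I • v k`. -/
theorem realFrame_true (v : Fin 2 → E) (k : Fin 2) : realFrame v (k, true) = I • v k := by
  simp [realFrame, twist]

/-- The complex inner products of the real frame, from those of `v`. -/
theorem inner_realFrame (v : Fin 2 → E) (hv : Orthonormal ℂ v) (p q : Fin 2 × Bool) :
    inner ℂ (realFrame v p) (realFrame v q) =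
      (starRingEnd ℂ) (twist p.2) * twist q.2 * (if p.1 = q.1 then 1 else 0) := by
  simp only [realFrame, inner_smul_left, inner_smul_right, orthonormal_iff_ite.mp hv]
  ring

/-- The real part of `conj (twist s) * twist t` is `δ_{st}`: the four cases
`conj 1 · 1 = 1`, `conj I · I = 1`, `conj 1 · I = I`, `conj I · 1 = −I`. -/
theorem re_conj_twist_mul_twist (s t : Bool) :
    ((starRingEnd ℂ) (twist s) * twist t).re = if s = t then 1 else 0 := by
  cases s <;> cases t <;> simp [twist, Complex.conj_I]

/-- **H2.1, first sentence.** The real frame is orthonormal for `g = Re h`. -/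
theorem re_inner_realFrame (v : Fin 2 → E) (hv : Orthonormal ℂ v) (p q : Fin 2 × Bool) :
    (inner ℂ (realFrame v p) (realFrame v q)).re = if p = q then (1 : ℝ) else 0 := by
  rw [inner_realFrame v hv]
  by_cases h : p.1 = q.1
  · simp only [h, if_true, mul_one, re_conj_twist_mul_twist]
    simp [Prod.ext_iff, h]
  · simp [h, Prod.ext_iff]

/-- The real frame is ℝ-linearly independent (pair a vanishing combination with each frame
vector and take real parts). -/
theorem linearIndependent_realFrame (v : Fin 2 → E) (hv : Orthonormal ℂ v) :
    LinearIndependent ℝ (realFrame v) := by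
  rw [Fintype.linearIndependent_iff]
  intro c hc q
  have h2 : inner ℂ (realFrame v q) (∑ p, c p • realFrame v p) =
      ∑ p, ((c p : ℝ) : ℂ) * inner ℂ (realFrame v q) (realFrame v p) := by
    rw [inner_sum]
    refine Finset.sum_congr rfl fun p _ => ?_
    rw [RCLike.real_smul_eq_coe_smul (K := ℂ), inner_smul_right]
    rfl
  have h3 : (inner ℂ (realFrame v q) (∑ p, c p • realFrame v p)).re = c q := by
    rw [h2, Complex.re_sum]
    simp only [Complex.re_ofReal_mul, re_inner_realFrame v hv]
    simp
  rw [hc, inner_zero_right, Complex.zero_re] at h3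
  exact h3.symm

/-- The real dimension of a complex plane is 4. -/
theorem finrank_real_eq_four (h : finrank ℂ E = 2) : finrank ℝ E = 4 := by
  rw [finrank_real_of_complex, h]

/-- **H2.1, first sentence, as a basis.** For `dim_ℂ E = 2` and a unitary pair `v`, the real
frame `e₁, Ie₁, e₂, Ie₂` is an ℝ-basis of `E`. -/
noncomputable def realBasis (v : Fin 2 → E) (hv : Orthonormal ℂ v) (h : finrank ℂ E = 2) :
    Basis (Fin 2 × Bool) ℝ E :=
  basisOfLinearIndependentOfCardEqFinrank (linearIndependent_realFrame v hv)
    (by rw [finrank_real_eq_four h]; simp)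

/-- The basis vectors are the frame vectors. -/
theorem coe_realBasis (v : Fin 2 → E) (hv : Orthonormal ℂ v) (h : finrank ℂ E = 2) :
    (realBasis v hv h : Fin 2 × Bool → E) = realFrame v :=
  coe_basisOfLinearIndependentOfCardEqFinrank _ _

/-- A unitary pair exists in every complex plane (Gram–Schmidt: Mathlib's
`stdOrthonormalBasis`, re-indexed by `finrank ℂ E = 2`). -/
theorem exists_orthonormal_pair [FiniteDimensional ℂ E] (h : finrank ℂ E = 2) :
    ∃ v : Fin 2 → E, Orthonormal ℂ v :=
  ⟨((stdOrthonormalBasis ℂ E).reindex (finCongr h) : Fin 2 → E),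
    ((stdOrthonormalBasis ℂ E).reindex (finCongr h)).orthonormal⟩

/-- The sentence in one statement: every complex plane with a hermitian inner product has a
real basis `e₁, Ie₁, e₂, Ie₂` orthonormal for `Re ⟪·,·⟫`. -/
theorem exists_realBasis_orthonormal [FiniteDimensional ℂ E] (h : finrank ℂ E = 2) :
    ∃ b : Basis (Fin 2 × Bool) ℝ E,
      (∀ p q, (inner ℂ (b p) (b q)).re = if p = q then (1 : ℝ) else 0) ∧
      ∀ k : Fin 2, b (k, true) = I • b (k, false) := by
  obtain ⟨v, hv⟩ := exists_orthonormal_pair h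
  refine ⟨realBasis v hv h, ?_, ?_⟩
  · intro p q
    rw [coe_realBasis]
    exact re_inner_realFrame v hv p q
  · intro k
    rw [coe_realBasis, realFrame_true, realFrame_false]

end Summit.Ventures.HodgeRepro2.T5UnitaryCoframe
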